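import Summits.QuantumFields.BalabanUV.Beta.EriceRemainderEnclosureHistoryAutonomyContinuity

/-!
# EriceRemainderEnclosureHistoryAutonomyMonotoneFlat — (E42) MONOTONE MEMORY WITH A FLAT BOTTOM NEEDS NOTHING: if the functional is
# NON-DECREASING in the history and INSENSITIVE below some level `x₁ > 0` (`B u = B u′` whenever all entries of `u, u′` are `≤ x₁` — the
# «flat bottom» that node U2's bump ∕ dip and (E38c)'s tent all HAVE), then two box solutions from one pin COINCIDE — with NO Lipschitz
# constant, NO size, NO range, NO concavity condition: asymptotic freedom drives both solutions below `x₁`, where their increments agree, and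
# monotonicity propagates the sign of the discrepancy DOWN the scales to the pin, where it vanishes.  So at a flat bottom non-uniqueness
# REQUIRES OSCILLATION of the memory: the tent's two slopes, not its height or steepness, make (E38c) work

Cell `pub-balaban`, β-function sub-cell, BINDER row D4 «RemainderConst leaves for Bałaban's split» (`HOME/BINDER-OWNERS.md`; owner
lineage `b2b-balaban-beta-an4`; this file by co-owner #2 lineage `b2b-balaban-beta-d4-p2`, generation 40), β-FLOW TEAM duty (1),
FREEZE (0) honoured (def-free; node U2's `MemFlow` ∕ `drive` ∕ `invSq_eq_of_memFlow`, (E40)'s `le_envelope_of_memFlow` ∕ `invSqrt_tail_le`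
BY NAME).  Companion of (E41) `…HistoryAutonomyMonotone` (monotone + SUB-HOMOGENEOUS ⟹ unique: Guo's cone argument) — here the concavity
is traded for a flat bottom and the argument is order-theoretic only; node U2's §8 `memFlow_unique_of_lagOne_monotone` (range one,
Lipschitz) is the third member of the family.  Whether monotonicity ALONE suffices (no flat bottom, no concavity, range ≥ 2) stays open.

HONEST FRAMING (page 1, verbatim and binding).  *"Discharging BetaPertH makes Bałaban's UV stability UNCONDITIONAL — a real
constructive-QFT result; it is NOT the continuum limit and NOT the Clay problem."*  THIS FILE DISCHARGES NOTHING OF THE KIND.  Pure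
order-theoretic real analysis about an ABSTRACT functional with displayed monotonicity, flat bottom and floor; which of these Bałaban's
limit functional has is NOT PRINTED and not asserted.  Row D4 class UNCHANGED (critical-path width 0; instance 0∕1; D4 DISCHARGE NO
DATE).  HONEST DEPENDENCY: continuum YM on T⁴ ⇐ BetaPertH ∧ nine spine estimates (0/9 proved); BetaPertH ⇐ (D1) ∧ (D4) ∧ CAP+tail;
G-an2-4 gates asym, D1 and NE2/3/4.

THE ARGUMENT ([folklore]).  `D_m = 1∕h_m² − 1∕h′_m² = drive B h m − drive B h′ m`, `D_0 = 0`.  Both solutions lie under the envelope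
`(1∕γ² + j·b)^{−1∕2}`, which is `≤ x₁` from some scale `J` on; so for `m ≥ J` the shifted histories `h(m+1+·)`, `h′(m+1+·)` are entrywise
`≤ x₁`, the increments `B(…)` agree, and `D_m = D_J =: c` for all `m ≥ J`.  Say `c ≥ 0` (else swap).  DOWNWARD INDUCTION: if `D_j ≥ 0` for
all `j ≥ m+1`, then `h_j ≤ h′_j` there, so `B(h(m+1+·)) ≤ B(h′(m+1+·))` and `D_m = D_{m+1} − (B(h…) − B(h′…)) ≥ D_{m+1} ≥ 0`.  Hence `D ≥ 0`
everywhere and `D` is non-increasing in the scale; with `D_0 = 0` this forces `D ≡ 0`, i.e. `h = h′`.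

WHAT IS PROVED ([folklore]; 0 `def`, 0 sorry).  §1 `invSq_sub_eq_drive_sub`, `envelope_le_level` (a scale `J` beyond which every box
solution with floor `b` is `≤ x₁`), `increment_eq_of_flat` (the increments of two solutions agree from `J` on), `disc_const_of_flat`
(`D_m = D_J` for `m ≥ J`).  §2 `le_of_one_div_sq_le'`, `disc_step_of_nonneg_above` (the downward step), `disc_nonneg_all` (downward induction),
**`eq_of_disc_tail_nonneg`** (monotone `B`: a sign-definite tail of the discrepancy forces equality — exported),
**`memFlow_unique_of_monotone_flat`** (monotone + flat bottom + floor ⟹ uniqueness; NO Lipschitz ∕ size ∕ range ∕ concavity),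
`existsUnique_memFlow_of_monotone_flat` (`∃!` from any existence witness — e.g. (E39) `exists_memFlow_zm` under a zeroth moment of any
size; (E39) is not imported here to keep this file on (E40) only).
-/

noncomputable section
open Filter Topology Finset

namespace Summit.QuantumFields.BalabanUV.Beta.EriceRemainderEnclosureHistoryAutonomyMonotoneFlat

open Literature.MathematicalPhysics.QuantumFieldTheory.Balaban1983to89
open Literature.MathematicalPhysics.QuantumFieldTheory.Balaban1983to89.T4BetaStationary
open Literature.MathematicalPhysics.QuantumFieldTheory.Balaban1983to89.T4BetaFlowWellPosed
open Summit.QuantumFields.BalabanUV.Beta.EriceRemainderEnclosureHistoryAutonomyContinuity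

variable {B : (ℕ → ℝ) → ℝ} {γ b gIR x₁ : ℝ} {h h' : ℕ → ℝ}

/-! ## §1 Beyond a scale `J` both solutions are below the level `x₁` and their increments agree -/

/-- The discrepancy of the recursion variables is the discrepancy of the driving sums. [folklore] -/
theorem invSq_sub_eq_drive_sub (hf : MemFlow B gIR h) (hf' : MemFlow B gIR h') (m : ℕ) :
    1 / h m ^ 2 - 1 / h' m ^ 2 = drive B h m - drive B h' m := by
  rw [invSq_eq_of_memFlow hf m, invSq_eq_of_memFlow hf' m]; ring

/-- **A SCALE BEYOND WHICH EVERY BOX SOLUTION IS BELOW THE LEVEL `x₁`** (floor `b > 0`, pins `≤ γ`): asymptotic freedom. [folklore] -/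
theorem envelope_le_level (hb : 0 < b) (hx₁ : 0 < x₁) :
    ∃ J : ℕ, ∀ (B : (ℕ → ℝ) → ℝ) (gIR : ℝ) (h : ℕ → ℝ), 0 < gIR → gIR ≤ γ → (∀ u, SeqBox γ u → b ≤ B u) →
      SeqBox γ h → MemFlow B gIR h → ∀ j, J ≤ j → h j ≤ x₁ := by
  obtain ⟨J, hJ⟩ := invSqrt_tail_le (γ := γ) hb hx₁
  exact ⟨J, fun B gIR h hgIR hgIRγ hlo hh hf j hj => (le_envelope_of_memFlow hb hgIR hgIRγ hlo hh hf j).trans (hJ j hj)⟩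

/-- FLAT BOTTOM ⟹ THE INCREMENTS AGREE beyond `J`: if `B u = B u′` whenever all entries of the box histories `u, u′` are `≤ x₁`, and both
solutions are `≤ x₁` from `J` on, then `B(h(m+1+·)) = B(h′(m+1+·))` for every `m ≥ J`. [folklore] -/
theorem increment_eq_of_flat
    (hflat : ∀ u u' : ℕ → ℝ, SeqBox γ u → SeqBox γ u' → (∀ j, u j ≤ x₁) → (∀ j, u' j ≤ x₁) → B u = B u')
    (hh : SeqBox γ h) (hh' : SeqBox γ h') {J : ℕ} (hJ : ∀ j, J ≤ j → h j ≤ x₁) (hJ' : ∀ j, J ≤ j → h' j ≤ x₁)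
    {m : ℕ} (hm : J ≤ m) : B (fun j => h (m + 1 + j)) = B (fun j => h' (m + 1 + j)) :=
  hflat _ _ (seqBox_shift hh (m + 1)) (seqBox_shift hh' (m + 1)) (fun j => hJ _ (by omega)) (fun j => hJ' _ (by omega))

/-- … so the discrepancy is CONSTANT beyond `J`: `1∕h_m² − 1∕h′_m² = 1∕h_J² − 1∕h′_J²` for `m ≥ J`. [folklore] -/
theorem disc_const_of_flat
    (hflat : ∀ u u' : ℕ → ℝ, SeqBox γ u → SeqBox γ u' → (∀ j, u j ≤ x₁) → (∀ j, u' j ≤ x₁) → B u = B u')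
    (hh : SeqBox γ h) (hh' : SeqBox γ h') (hf : MemFlow B gIR h) (hf' : MemFlow B gIR h') {J : ℕ}
    (hJ : ∀ j, J ≤ j → h j ≤ x₁) (hJ' : ∀ j, J ≤ j → h' j ≤ x₁) :
    ∀ m, J ≤ m → 1 / h m ^ 2 - 1 / h' m ^ 2 = 1 / h J ^ 2 - 1 / h' J ^ 2 := by
  intro m hm
  induction m, hm using Nat.le_induction with
  | base => rfl
  | succ m hm ih =>
    rw [hf.2 m, hf'.2 m, increment_eq_of_flat hflat hh hh' hJ hJ' hm, ← ih]
    ring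

/-! ## §2 Monotonicity propagates the sign of the discrepancy down to the pin -/

/-- `0 < x`, `0 < y`, `1∕y² ≤ 1∕x²` ⟹ `x ≤ y`. [folklore] -/
theorem le_of_one_div_sq_le' {x y : ℝ} (hx : 0 < x) (hy : 0 < y) (hxy : 1 / y ^ 2 ≤ 1 / x ^ 2) : x ≤ y := by
  have := (one_div_le_one_div (pow_pos hy 2) (pow_pos hx 2)).1 hxy
  exact (pow_le_pow_iff_left₀ hx.le hy.le two_ne_zero).1 this

/-- THE DOWNWARD STEP: if `1∕h_j² ≥ 1∕h′_j²` (i.e. `h_j ≤ h′_j`) for every `j ≥ m + 1` and `B` is non-decreasing in the history, then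
`1∕h_m² − 1∕h′_m² ≥ 1∕h_{m+1}² − 1∕h′_{m+1}²`. [folklore] -/
theorem disc_step_of_nonneg_above
    (hmono : ∀ u v : ℕ → ℝ, SeqBox γ u → SeqBox γ v → (∀ j, u j ≤ v j) → B u ≤ B v)
    (hh : SeqBox γ h) (hh' : SeqBox γ h') (hf : MemFlow B gIR h) (hf' : MemFlow B gIR h') {m : ℕ}
    (habove : ∀ j, m + 1 ≤ j → 0 ≤ 1 / h j ^ 2 - 1 / h' j ^ 2) :
    1 / h (m + 1) ^ 2 - 1 / h' (m + 1) ^ 2 ≤ 1 / h m ^ 2 - 1 / h' m ^ 2 := by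
  have hle : ∀ j, h (m + 1 + j) ≤ h' (m + 1 + j) := fun j => by
    have h0 := habove (m + 1 + j) (by omega)
    have h1 : 1 / h' (m + 1 + j) ^ 2 ≤ 1 / h (m + 1 + j) ^ 2 := by linarith
    exact le_of_one_div_sq_le' (hh (m + 1 + j)).1 (hh' (m + 1 + j)).1 h1
  have hB := hmono _ _ (seqBox_shift hh (m + 1)) (seqBox_shift hh' (m + 1)) hle
  rw [hf.2 m, hf'.2 m]
  linarith

/-- DOWNWARD INDUCTION: if the discrepancy is `≥ 0` at every scale `≥ J`, it is `≥ 0` at EVERY scale (monotone `B`). [folklore] -/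
theorem disc_nonneg_all
    (hmono : ∀ u v : ℕ → ℝ, SeqBox γ u → SeqBox γ v → (∀ j, u j ≤ v j) → B u ≤ B v)
    (hh : SeqBox γ h) (hh' : SeqBox γ h') (hf : MemFlow B gIR h) (hf' : MemFlow B gIR h') {J : ℕ}
    (htail : ∀ j, J ≤ j → 0 ≤ 1 / h j ^ 2 - 1 / h' j ^ 2) : ∀ j, 0 ≤ 1 / h j ^ 2 - 1 / h' j ^ 2 := by
  -- `P n`: nonnegativity at every scale `≥ J − n`
  have key : ∀ n : ℕ, ∀ j, J - n ≤ j → 0 ≤ 1 / h j ^ 2 - 1 / h' j ^ 2 := by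
    intro n
    induction n with
    | zero => simpa using htail
    | succ n ih =>
      intro j hj
      by_cases hj' : J - n ≤ j
      · exact ih j hj'
      · -- `j = J − (n+1)` and `j + 1 = J − n`
        have hj1 : J - n ≤ j + 1 := by omega
        have hstep := disc_step_of_nonneg_above hmono hh hh' hf hf' (m := j) fun i hi => ih i (by omega)
        exact (ih (j + 1) hj1).trans hstep
  intro j
  exact key J j (by omega)

/-- **A SIGN-DEFINITE TAIL FORCES EQUALITY** (monotone `B`): if two box solutions from one pin have `1∕h_j² ≥ 1∕h′_j²` for EVERY
`j ≥ J`, then `h = h′` — the discrepancy is `≥ 0` everywhere (`disc_nonneg_all`), non-increasing in the scale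
(`disc_step_of_nonneg_above`) and `0` at the pin.  Exported for (E43)-type arguments where the tail sign comes from convergence rather
than from a flat bottom. [folklore] -/
theorem eq_of_disc_tail_nonneg
    (hmono : ∀ u v : ℕ → ℝ, SeqBox γ u → SeqBox γ v → (∀ j, u j ≤ v j) → B u ≤ B v)
    (hh : SeqBox γ h) (hh' : SeqBox γ h') (hf : MemFlow B gIR h) (hf' : MemFlow B gIR h') {J : ℕ}
    (htail : ∀ j, J ≤ j → 0 ≤ 1 / h j ^ 2 - 1 / h' j ^ 2) : h = h' := by
  have hall := disc_nonneg_all hmono hh hh' hf hf' htail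
  have hanti : ∀ m, 1 / h (m + 1) ^ 2 - 1 / h' (m + 1) ^ 2 ≤ 1 / h m ^ 2 - 1 / h' m ^ 2 := fun m =>
    disc_step_of_nonneg_above hmono hh hh' hf hf' fun j _ => hall j
  have h0 : 1 / h 0 ^ 2 - 1 / h' 0 ^ 2 = 0 := by rw [hf.1, hf'.1, sub_self]
  have hle0 : ∀ m, 1 / h m ^ 2 - 1 / h' m ^ 2 ≤ 0 := by
    intro m
    induction m with
    | zero => exact h0.le
    | succ m ih => exact (hanti m).trans ih
  funext m
  have hz : 1 / h m ^ 2 - 1 / h' m ^ 2 = 0 := le_antisymm (hle0 m) (hall m)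
  have h1 : 1 / h m ^ 2 = 1 / h' m ^ 2 := sub_eq_zero.1 hz
  have h2 : h m ^ 2 = h' m ^ 2 := by
    have := congrArg (fun x : ℝ => 1 / x) h1
    simpa only [one_div_one_div] using this
  exact (pow_left_inj₀ (hh m).1.le (hh' m).1.le two_ne_zero).1 h2

/-- **MONOTONE MEMORY WITH A FLAT BOTTOM NEEDS NOTHING.**  `B` non-decreasing in the history (pointwise order on the box ]0,γ]^ℕ), flat
below a level `x₁ > 0` (`B u = B u′` when all entries of `u, u′` are `≤ x₁`), floor `b > 0`; pin `gIR ∈ ]0,γ]`.  Then two box solutions of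
the flow with memory from `gIR` COINCIDE — no Lipschitz constant, no size, no range, no concavity. [folklore] -/
theorem memFlow_unique_of_monotone_flat
    (hmono : ∀ u v : ℕ → ℝ, SeqBox γ u → SeqBox γ v → (∀ j, u j ≤ v j) → B u ≤ B v)
    (hflat : ∀ u u' : ℕ → ℝ, SeqBox γ u → SeqBox γ u' → (∀ j, u j ≤ x₁) → (∀ j, u' j ≤ x₁) → B u = B u')
    (hx₁ : 0 < x₁) (hgIR : 0 < gIR) (hgIRγ : gIR ≤ γ) (hb : 0 < b) (hlo : ∀ u, SeqBox γ u → b ≤ B u)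
    (hh : SeqBox γ h) (hh' : SeqBox γ h') (hf : MemFlow B gIR h) (hf' : MemFlow B gIR h') : h = h' := by
  obtain ⟨J, hJ⟩ := envelope_le_level (γ := γ) hb hx₁
  have hJh : ∀ j, J ≤ j → h j ≤ x₁ := hJ B gIR h hgIR hgIRγ hlo hh hf
  have hJh' : ∀ j, J ≤ j → h' j ≤ x₁ := hJ B gIR h' hgIR hgIRγ hlo hh' hf'
  have hconst := disc_const_of_flat hflat hh hh' hf hf' hJh hJh'
  have hconst' := disc_const_of_flat hflat hh' hh hf' hf hJh' hJh
  -- the sign of the tail constant decides which solution plays `h`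
  rcases le_total 0 (1 / h J ^ 2 - 1 / h' J ^ 2) with hc | hc
  · exact eq_of_disc_tail_nonneg hmono hh hh' hf hf' (J := J) fun j hj => by rw [hconst j hj]; exact hc
  · have hc' : 0 ≤ 1 / h' J ^ 2 - 1 / h J ^ 2 := by linarith
    exact (eq_of_disc_tail_nonneg hmono hh' hh hf' hf (J := J) fun j hj => by rw [hconst' j hj]; exact hc').symm

/-- With an existence witness (e.g. (E39) `exists_memFlow_zm` under any zeroth moment), `∃!`. [folklore] -/
theorem existsUnique_memFlow_of_monotone_flat
    (hmono : ∀ u v : ℕ → ℝ, SeqBox γ u → SeqBox γ v → (∀ j, u j ≤ v j) → B u ≤ B v)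
    (hflat : ∀ u u' : ℕ → ℝ, SeqBox γ u → SeqBox γ u' → (∀ j, u j ≤ x₁) → (∀ j, u' j ≤ x₁) → B u = B u')
    (hx₁ : 0 < x₁) (hgIR : 0 < gIR) (hgIRγ : gIR ≤ γ) (hb : 0 < b) (hlo : ∀ u, SeqBox γ u → b ≤ B u)
    (hex : ∃ h : ℕ → ℝ, SeqBox γ h ∧ MemFlow B gIR h) : ∃! h : ℕ → ℝ, SeqBox γ h ∧ MemFlow B gIR h := by
  obtain ⟨h, hh, hf⟩ := hex
  exact ⟨h, ⟨hh, hf⟩, fun h' hh' => memFlow_unique_of_monotone_flat hmono hflat hx₁ hgIR hgIRγ hb hlo hh'.1 hh hh'.2 hf⟩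

end Summit.QuantumFields.BalabanUV.Beta.EriceRemainderEnclosureHistoryAutonomyMonotoneFlat

end
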